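import Summits.Langlands.Langlands.Theses.WeilRestrictionSplit
import Summits.Langlands.Langlands.Theorems.WeilRestrictionSplitWeilRestrictionConstituentTrace
import Summits.Langlands.Langlands.Theorems.WeilRestrictionSplitWeilRestrictionConstituentSelection
import Summits.Langlands.Langlands.Theorems.WeilRestrictionSplitWeilRestrictionConstituentMackey
import Literature.NumberTheory.PAdicHodge.FontainePstInductionSchemataProofs
import Literature.NumberTheory.GaloisRepresentations.InducedAEUnramified

/-!
# S3 `WeilRestrictionConstituent` (route WeilRestrictionSplit, item stmt-Langlands-31696) — proved

For a tower of number fields `F₀ ⊆ K ⊆ E`, a prime `ℓ` and an irreducible PINNED-GEOMETRIC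
`ρ : Γ_K →ₜ* GL_n(ℚ̄_ℓ)` (`n ≥ 1`), there are an irreducible pinned-geometric constituent
`ϑ : Γ_E →ₜ* GL_m(ℚ̄_ℓ)` of `ρ|_{Γ_E}` (`tr ρ|_E = tr ϑ + tr ϑᶜ`) and an irreducible pinned-geometric
`R : Γ_{F₀} →ₜ* GL_N(ℚ̄_ℓ)` with `ϑ` a constituent of `R|_{Γ_E}` (`tr R|_E = tr ϑ + tr Rᶜ`).

Proof (everything from the tree, no named fact taken as a hypothesis):
* `ρ|_E` is pinned-geometric (`eventually_isUnramifiedAt_restrictField`; de Rham by the DISCHARGED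
  Brinon–Conrad base change `DeRhamBaseChange_holds` via `isDeRhamFramed_toLocal_restrictField`), so
  it has an irreducible pinned-geometric constituent `ϑ` with complement in trace form
  (`exists_irreducible_geometric_constituent_trace`, Jordan–Hölder dévissage).
* `I := Ind_{Γ_E}^{Γ_{F₀}} ϑ` (`FramedGaloisRep.induce`) is pinned-geometric
  (`eventually_isUnramifiedAt_induce`; Patrikis Lemma 7.2.1 = `IsDeRhamFramedInduceSchema_holds`),
  and `ϑ' := ϑ(σ₁) ϑ ϑ(σ₁)⁻¹ ↪ I|_{Γ_E}` as the block of the trivial coset (Mackey at the trivial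
  coset for arbitrary finite `E/F₀`, vector form `exists_embedding_induce_restrictField`).
* Frobenius reciprocity for constituents (`exists_irreducible_subquotient`): an irreducible
  subquotient `R` of `I` with `ϑ' ↪ R|_{Γ_E}`; `R` is pinned-geometric by block heredity twice
  (`isUnramifiedAt_blocks`, Fontaine Exp. III Prop. 1.5.2 = `stub_deRhamBlocks`); and in a frame of
  `R|_{Γ_E}` adapted to the image of `ϑ'` the corner has the character of `ϑ'`, i.e. of `ϑ`
  (`exists_corner_trace_eq`, `trace_conj`).

References: J.-P. Serre, *Linear representations of finite groups* (1977), §7.2–7.3;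
J.-M. Fontaine, Astérisque 223 (1994), Exp. III Prop. 1.5.2; O. Brinon, B. Conrad, *CMI notes on
p-adic Hodge theory* (2009), Prop. 6.3.8; S. Patrikis, *Variations on a theorem of Tate* (2019),
Lemma 7.2.1.
-/

noncomputable section

set_option linter.dupNamespace false -- project-wide option (lakefile weak.linter.dupNamespace); `Summit.Langlands.Langlands` is the mandated namespace

open scoped NumberField MatrixGroups Matrix
open Filter IsDedekindDomain Field
open Literature.NumberTheory.GaloisRepresentations Literature.NumberTheory.PAdicHodge
open Summit.Langlands.Langlands.Theorems.ReciprocityUpToIrreducibility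
open Summit.Langlands.Langlands.Theorems.WeilRestrictionConstituentProof

namespace Summit.Langlands.Langlands.Theorems

/-- **S3 (item stmt-Langlands-31696): the Weil-restriction constituent.**  For a tower of number
fields `F₀ ⊆ K ⊆ E` and an irreducible pinned-geometric `ρ : Γ_K →ₜ* GL_n(ℚ̄_ℓ)`, `n ≥ 1`, there are
an irreducible pinned-geometric constituent `ϑ` of `ρ|_{Γ_E}` of rank `≥ 1`
(`tr ρ|_E = tr ϑ + tr ϑᶜ`) and an irreducible pinned-geometric `R : Γ_{F₀} →ₜ* GL_N(ℚ̄_ℓ)`, `N ≥ 1`,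
with `ϑ` a constituent of `R|_{Γ_E}` (`tr R|_E = tr ϑ + tr Rᶜ`) — an irreducible subquotient of the
Weil restriction `Ind_{Γ_E}^{Γ_{F₀}} ϑ` through which the unit of Frobenius reciprocity factors.
Serre, *Linear representations* §7.2–7.3; Fontaine Exp. III Prop. 1.5.2; Brinon–Conrad Prop. 6.3.8;
Patrikis 2019 Lemma 7.2.1 — all discharged in the tree. -/
theorem WeilRestrictionConstituent_proof :
    Summit.Langlands.Langlands.Theses.WeilRestrictionSplit.WeilRestrictionConstituent := by
  intro F₀ K E _ _ _ _ _ _ _ _ _ _ n ℓ _ ρ _ hgeo hn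
  -- Step A: `ρ|_E` is pinned-geometric; an irreducible constituent `ϑ` with complement
  have hgeoE : (∀ᶠ w : HeightOneSpectrum (𝓞 E) in cofinite, (ρ.restrictField E).IsUnramifiedAt w) ∧
      ∀ (w : HeightOneSpectrum (𝓞 E)) (hw : ((ℓ : ℕ) : 𝓞 E) ∈ w.asIdeal),
        (fontainePstAdicCompletion w ℓ hw).IsDeRhamFramed ((ρ.restrictField E).toLocal w) :=
    ⟨ρ.eventually_isUnramifiedAt_restrictField hgeo.1,
      fun w hw ↦ isDeRhamFramed_toLocal_restrictField DeRhamBaseChange_holds ρ hgeo.2 w hw⟩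
  obtain ⟨m, ϑ, mc, θc, hm, hϑirr, hϑgeo, htr⟩ :=
    exists_irreducible_geometric_constituent_trace E ℓ (ρ.restrictField E) hn hgeoE
  refine ⟨m, ϑ, hm, hϑirr, hϑgeo, ⟨mc, θc, htr⟩, ?_⟩
  -- Step B: the Weil restriction `I = Ind_{Γ_E}^{Γ_{F₀}} ϑ` and the trivial-coset block
  obtain ⟨d, hd⟩ : ∃ d, Module.finrank F₀ E = d := ⟨_, rfl⟩
  obtain ⟨σ₁, f, hf, hfeq⟩ := exists_embedding_induce_restrictField F₀ E hd ϑ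
  have hIunr : ∀ᶠ v : HeightOneSpectrum (𝓞 F₀) in cofinite, (ϑ.induce F₀ hd).IsUnramifiedAt v :=
    FramedGaloisRep.eventually_isUnramifiedAt_induce F₀ hd ϑ hϑgeo.1
  have hIdR : ∀ (v : HeightOneSpectrum (𝓞 F₀)) (hv : ((ℓ : ℕ) : 𝓞 F₀) ∈ v.asIdeal),
      (fontainePstAdicCompletion v ℓ hv).IsDeRhamFramed ((ϑ.induce F₀ hd).toLocal v) :=
    IsDeRhamFramedInduceSchema_holds F₀ E d hd ℓ m ϑ hϑgeo.2
  -- `f` embeds `ϑ' = ϑ(σ₁) ϑ ϑ(σ₁)⁻¹` into `I|_{Γ_E}` (`(I|_E)(σ) = I(res σ)` by definition)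
  have hfeq' : ∀ (σ : absoluteGaloisGroup E) (x : Fin m → PadicAlgCl ℓ),
      Matrix.mulVec (((ϑ.induce F₀ hd) ((absGaloisRestrict F₀ E).toMonoidHom σ) :
          GL (Fin (d * m)) (PadicAlgCl ℓ)) : Matrix (Fin (d * m)) (Fin (d * m)) (PadicAlgCl ℓ))
        (f x) =
      f (Matrix.mulVec (((FramedRep.conj (ϑ σ₁) ϑ).toMonoidHom σ : GL (Fin m) (PadicAlgCl ℓ)) :
        Matrix (Fin m) (Fin m) (PadicAlgCl ℓ)) x) := fun σ x ↦ hfeq σ x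
  -- irreducibility of `ϑ'` from that of `ϑ`
  have hθ : ∀ S : Submodule (PadicAlgCl ℓ) (Fin m → PadicAlgCl ℓ),
      (∀ σ x, x ∈ S → (((FramedRep.conj (ϑ σ₁) ϑ).toMonoidHom σ : GL (Fin m) (PadicAlgCl ℓ)) :
        Matrix (Fin m) (Fin m) (PadicAlgCl ℓ)) *ᵥ x ∈ S) → S = ⊥ ∨ S = ⊤ := by
    intro S hS
    let W : Subrepresentation (FramedRep.toRepresentation ϑ) :=
      ⟨S, fun τ x hx ↦ by
        have h := hS (σ₁⁻¹ * τ * σ₁) x hx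
        have hτ : (FramedRep.conj (ϑ σ₁) ϑ).toMonoidHom (σ₁⁻¹ * τ * σ₁) = ϑ τ := by
          change ϑ σ₁ * ϑ (σ₁⁻¹ * τ * σ₁) * (ϑ σ₁)⁻¹ = ϑ τ
          rw [map_mul, map_mul, map_inv]
          group
        rw [hτ] at h
        exact h⟩
    rcases hϑirr.eq_bot_or_eq_top W with h | h
    · exact Or.inl (congrArg Subrepresentation.toSubmodule h)
    · exact Or.inr (congrArg Subrepresentation.toSubmodule h)
  -- Frobenius reciprocity for constituents: an irreducible subquotient `R` of `I` with `ϑ' ↪ R|_E`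
  obtain ⟨a, pa, ea, P₁, X, Z, ba, b, eb, P₂, Y, R, f₂, hT₁, hT₂, hb, hRirr, hf₂, hf₂eq⟩ :=
    exists_irreducible_subquotient (ϑ.induce F₀ hd) (absGaloisRestrict F₀ E).toMonoidHom
      (FramedRep.conj (ϑ σ₁) ϑ).toMonoidHom hm hθ f hf hfeq'
  -- `R` is pinned-geometric (block heredity, twice)
  have hXunr : ∀ v : HeightOneSpectrum (𝓞 F₀), (ϑ.induce F₀ hd).IsUnramifiedAt v →
      FramedGaloisRep.IsUnramifiedAt v X := fun v hv ↦
    (isUnramifiedAt_blocks ea P₁ (ϑ.induce F₀ hd) X Z hT₁ hv).1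
  have hXdR : ∀ (v : HeightOneSpectrum (𝓞 F₀)) (hv : ((ℓ : ℕ) : 𝓞 F₀) ∈ v.asIdeal),
      (fontainePstAdicCompletion v ℓ hv).IsDeRhamFramed (FramedGaloisRep.toLocal v X) :=
    fun v hv ↦ (isDeRhamFramed_blocks stub_deRhamBlocks ea P₁ (ϑ.induce F₀ hd) X Z hT₁ v hv
      (hIdR v hv)).1
  have hRunr : ∀ᶠ v : HeightOneSpectrum (𝓞 F₀) in cofinite, FramedGaloisRep.IsUnramifiedAt v R :=
    hIunr.mono fun v hv ↦ (isUnramifiedAt_blocks eb P₂ X Y R hT₂ (hXunr v hv)).2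
  have hRdR : ∀ (v : HeightOneSpectrum (𝓞 F₀)) (hv : ((ℓ : ℕ) : 𝓞 F₀) ∈ v.asIdeal),
      (fontainePstAdicCompletion v ℓ hv).IsDeRhamFramed (FramedGaloisRep.toLocal v R) :=
    fun v hv ↦ (isDeRhamFramed_blocks stub_deRhamBlocks eb P₂ X Y R hT₂ v hv (hXdR v hv)).2
  -- the corner of `R|_{Γ_E}` along the image of `ϑ'` has the character of `ϑ`
  obtain ⟨c, pc, ec, Q, C, C', hT₃, hCtr⟩ :=
    exists_corner_trace_eq (FramedGaloisRep.restrictField E R)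
      (FramedRep.conj (ϑ σ₁) ϑ).toMonoidHom f₂ hf₂ hf₂eq
  refine ⟨b, R, hb, hRirr, ⟨hRunr, hRdR⟩, pc, C', fun σ ↦ ?_⟩
  rw [← trace_conj Q (FramedGaloisRep.restrictField E R) σ,
    trace_eq_add_of_blockTriangular ec _ C C' hT₃ σ, hCtr σ]
  exact congrArg (· + FramedRep.trace C' σ) (trace_conj (ϑ σ₁) ϑ σ)

end Summit.Langlands.Langlands.Theorems

end
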